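import Literature.MathematicalPhysics.QuantumFieldTheory.Balaban1983to89.B12Eq213Body268

/-!
# `Balaban1983to89.B12Eq213AnalyticHistory` — T. Bałaban, *Renormalization group approach to lattice gauge field theories. I*,
Commun. Math. Phys. **109** (1987) 249–301 [Balaban1987RG1], (2.13) p. 268 with p. 263 ll. 22–28 *«C^∞ … (or analytic)»*, p. 266
after (2.9) *«the functions 𝐄^{(j)}, β_j are analytic functions of the effective coupling constants»* (PLURAL: all the
constants `g_0, …, g_{j−1}` of the sequence, p. 256 (0.23)), (2.1) p. 265 ∕ (2.11)–(2.12) pp. 267–268 (the old action enters the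
new one only composed with the fluctuated field): **the «(or analytic)» clause FOR THE OLDER COUPLINGS on the body — the
analytic history tower keeps a FIXED strip.  THE CONE COMPARISON PRINCIPLE: for a complex exponent `F` with `|Im F| ≤ m < π∕2` on
the support of `χ`, the *«integral above»* `∫ χ e^{F} dμ` lies in the sector `|arg| ≤ m` (factor ONE) with modulus between
`cos m·∫χe^{Re F}` and `∫χe^{Re F}`; hence `log ∫χe^{F}` is holomorphic in any parameter the exponent is holomorphic in, with the
SAME imaginary-part letter `m`, and along the (0.23)+(2.13) recursion the sections `z ↦ 𝐄_k(g_0, …, g_i := z, …, g_{k−1}; U)` stay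
holomorphic on ONE complex neighbourhood of the coupling window for every age `k − i`; kernel-checked on the body of record**

statement-level skeleton of published theorems with citation tags; proofs where landed; nothing here is a claim about
the Yang–Mills mass gap

PDF held: `paper:balaban1987-cmp109-rg-i-small-field` (journal page = PDF page + 248); pp. 256, 263, 265–268 re-read this session from
the text layer.

CITATION HEADER / WHAT IS REPRODUCED (cell `pub-ymgap`, HUMAN RULING D-0062 Track A, seat `pub-ymgap-dag-n22-b` = the
FIRST-MISSING-ESTIMATE seat of DAG node N22 = NE9; thirteenth module of the body-level chain — the OLDER-COUPLING companion of
module 8 `B12Eq213AnalyticCoupling` (last coupling) and the analytic companion of module 9 `B12Eq213HistoryTowerSharp` (Lipschitz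
history tower); a NEW LEAF over r20's `B12Eq213Body268`, nothing there modified).

THE PRINT.  p. 263 ll. 22–28: *«It is a C^∞-function of g_{j−1} ∈ [0, γ], (or analytic), with a positive, absolute γ.»* — the
regularity TYPE is printed for the LAST coupling only; p. 266 (after (2.9)): *«It has the advantage that the functions 𝐄^{(j)}, β_j
are analytic functions of the effective coupling constants»* — plural, no domain, no proof; p. 256 (0.23) and p. 298: the actions
depend on the whole sequence `g_0, …, g_{k−1}` (words).  (2.1) p. 265 ∕ (2.11) p. 267 ∕ (2.12)–(2.13) p. 268: the step-`k` integrand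
carries the old action ONLY as `𝐄_k(U_k(exp i[g_kCB − hD̃(g_kCB)]V^{(k)}))`, i.e. composed with the fluctuated field, at the REAL last
coupling `g_k`; an OLDER coupling `g_i`, `i < k`, therefore enters the new term only through the values of `𝐄_k`.  Print proves
nothing about the dependence on the older couplings (cell GAPS G-t4-U3-3; node N22's «OBJECT-bound» residual).

WHAT THIS MODULE DOES (THEOREMS ONLY; no definition, no named fact).
* §1 **THE CONE COMPARISON PRINCIPLE** (generic small-field integral `∫ χ e^{F} dμ`, `0 ≤ χ`, complex exponent `F`): if
  `|Im F| ≤ m < π∕2` on `{χ ≠ 0}` then `cos m · ∫χe^{Re F} ≤ Re ∫χe^{F}`, `|Im ∫χe^{F}| ≤ tan m · Re ∫χe^{F}`, `‖∫χe^{F}‖ ≤ ∫χe^{Re F}`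
  (`cos_mul_integral_le_re`, `abs_im_integral_le`, `norm_integral_le_real`); hence, the real shadow `∫χe^{Re F}` being positive,
  **`|Im log ∫χe^{F}| ≤ m`** — the imaginary-part letter passes through the logarithm of the fluctuation integral with factor ONE —
  and `log cos m ≤ Re log ∫χe^{F} − log ∫χe^{Re F} ≤ 0` (`abs_im_clog_integral_le`, `re_clog_integral_le` ∕ `le_re_clog_integral`).
* §2 **THE PARAMETRISED NEW TERM** `J(z) = ∫ χ e^{p + q_z} dμ` with a real base exponent `p` (print's `𝐏^{(k)}(g_k, U, B)` at the real
  last coupling) and a complex bracket family `q_z` (print's `𝐄_k ∘ (fluctuated field)` with one older coupling complexified) which,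
  on `{χ ≠ 0}`, is holomorphic in `z` on an open convex `O ⊆ ℂ` closed under `z ↦ Re z`, with derivative letter `Λ`, imaginary-part
  letter `m < π∕2`, real on real points (`q_t = q^ℝ_t`), the real integrands integrable with positive integrals: `J` is HOLOMORPHIC on
  `O` with derivative the `q′`-weighted integral (`hasDerivAt_paramIntegral`), `‖J′‖ ≤ Λ·∫χe^{p + Re q_z}`, and the new term
  `z ↦ log J(z)` is holomorphic on `O` with **derivative letter `Λ ∕ cos m`, imaginary-part letter `m` (unchanged)**, equal to the
  real new term `log ∫χe^{p + q^ℝ_t}` at real `t` (`clog_paramIntegral_letters`).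
* §3 **THE ANALYTIC HISTORY TOWER WITH A FIXED STRIP**: the un-subtracted recursion of `B12Eq213HistoryTowerSharp` §2,
  `E (k+1) h U = newTerm {D k with Q := 𝐄_k^h ∘ τ k} (h k) U + R k (h k) U`, for the histories `h = (g with g_i := t)`, `t` real, and
  its complexification `Ec (k+1) z U = log ∫ χ e^{𝐏_k(g_k) + Ec k z ∘ τ k(g_k)} + R k (g k) U` in the one older coupling `g_i := z ∈ O`:
  from a BIRTH LETTER at level `i + 1` (holomorphy on `O`, imaginary-part letter `m`, derivative letter `Λ₀`, real compatibility —
  the shape module 8 `B12Eq213AnalyticCoupling.differentiableOn_cintegral` delivers for the last coupling), for EVERY `k > i` and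
  `U ∈ Dom k`: `z ↦ Ec k z U` is holomorphic on the SAME `O`, **`|Im Ec k z U| ≤ m` (the strip never shrinks with the age)**,
  `‖∂_z Ec k z U‖ ≤ Λ₀·(cos m)^{−(k−1−i)}` (geometric in the age — any geometric rate is tolerated downstream), and
  `Ec k t U = E k (g with g_i := t) U` on real points (`analyticHistory_letters`); consequently
  `‖Ec k z U − E k (g with g_i := Re z) U‖ ≤ Λ₀(cos m)^{−(k−1−i)}·|Im z|` (`norm_sub_real_le_of_letters`).
HONEST READING.  This is the body-level MECHANISM by which coordinate analyticity in an older coupling survives the later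
renormalization steps with a uniform complex margin; it is what the ROAD-3 knit of node N22 (`BalabanUVNodesN22KnitTwoConstants`,
uniform-margin coordinate-disc analyticity with at-most-geometric bounds) consumes on the E-side.  DISPLAYED, not supplied: the birth
letter (module 8's holomorphic extension of `𝐏^{(i)} + {…}` in the last coupling, i.e. (1.17) ∘ the substitution and
`B12ZeroCoupling268`), measurability ∕ integrability ∕ positivity of the integrands (as in every module of the chain), and — as
always on the un-localised body — localization into `𝐄^{(k)}(X)` with `e^{−κd(X)}` (W1): the letters here concern `𝐄_k` itself, whose
DIFFERENCES and derivatives are the body's currency.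

WHAT IS *NOT* HERE: the sup bound `M·μ^{age}·e^{−κd}` of the knit's letter (A) (a localized statement); uniformity in the volume;
anything about `β_k`.  HONEST FRAMING: count-neutral Track-A side module; NOT a discharge of node N22; one finite T⁴ programme at
fixed ε, Bałaban AS PRINTED with locators; nothing continuum ∕ ℝ⁴ ∕ OS ∕ mass-gap ∕ Clay.

v1.1 (APPEND-ONLY, same seat; §§1–3 byte-identical): §4 `birth_letters` — the four-part BIRTH letter of `analyticHistory_letters` (level
`i + 1`, where the complexified coupling is the LAST one and enters `𝐏^{(i)}`, the bracket and the remainder `R_i`) from EXPONENT-LEVEL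
letters: holomorphy, `|Im| ≤ m₁`, `‖∂_z‖ ≤ L₁`, real compatibility for the exponent (DISPLAYED — (1.17) ∘ the substitution,
`B12Eq212BracketCoupling`, `B12ZeroCoupling268`) and `m₂, L₂` for the remainder give the birth action the imaginary-part letter `m₁ + m₂` and
the derivative letter `L₁ ∕ cos m₁ + L₂` (§2 with the real base `p := 0`).  With §4 the older-coupling analytic tower's only displayed
ANALYTIC inputs are exponent-level; everything else displayed is measurability ∕ integrability ∕ positivity.

v1.2 (APPEND-ONLY, same seat; §§1–4 byte-identical): §5 THE EXPONENT'S LETTERS FROM ITS PARTS — `exponent_letters_add` (the four letters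
of a sum `𝐏 + {…}` from those of the parts: imaginary-part and derivative letters add) and `letters_of_norm_le` (a part holomorphic on a
larger coupling disc `|z − c| < r′` with `‖·‖ ≤ M` there has, on `|z − c| < r`, the imaginary-part letter `M` and the derivative letter
`M ∕ (r′ − r)` — Cauchy's estimate; the shape lit-balaban's `B12ZeroCoupling268` supplies for the displayed terms of `𝐏^{(k)}`:
analyticity on the disc `|g|‖X‖ < ε` with explicit sup bounds), so that §4's exponent-level hypotheses assemble BY NAME from
`B12Eq212BracketCoupling.bracket_complex_letters` (the `{…}`-part) and `B12ZeroCoupling268` (the `𝐏`-part).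
-/

noncomputable section

namespace Literature.MathematicalPhysics.QuantumFieldTheory.Balaban1983to89.B12Eq213AnalyticHistory

open _root_.MeasureTheory Complex Set Filter
open scoped BigOperators Real Topology
open Literature.MathematicalPhysics.QuantumFieldTheory.Balaban1983to89
open Literature.MathematicalPhysics.QuantumFieldTheory.Balaban1983to89.B12Eq213Body268 (FluctData)

/-! ## §1. The cone comparison principle for `∫ χ e^{F} dμ` with a complex exponent -/

section Cone

variable {Ω : Type*} [MeasurableSpace Ω] {μ : Measure Ω}

/-- Trigonometry of the cone: `|x| ≤ m < π∕2` gives `|sin x| ≤ tan m · cos x`. [folklore] -/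
private theorem abs_sin_le_tan_mul_cos {x m : ℝ} (hx : |x| ≤ m) (hm : m < π / 2) :
    |Real.sin x| ≤ Real.tan m * Real.cos x := by
  have hx' := abs_le.1 hx
  have hxI : x ∈ Ioo (-(π / 2)) (π / 2) := ⟨by linarith, by linarith⟩
  have hcos : 0 < Real.cos x := Real.cos_pos_of_mem_Ioo hxI
  have htan : |Real.tan x| ≤ Real.tan m := by
    rw [abs_le]
    refine ⟨?_, ?_⟩
    · have h := Real.strictMonoOn_tan.monotoneOn (a := -m) (b := x) ⟨by linarith, by linarith⟩ hxI (by linarith)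
      rwa [Real.tan_neg] at h
    · exact Real.strictMonoOn_tan.monotoneOn hxI ⟨by linarith, hm⟩ hx'.2
  calc |Real.sin x| = |Real.tan x * Real.cos x| := by rw [Real.tan_mul_cos hcos.ne']
    _ = |Real.tan x| * Real.cos x := by rw [abs_mul, abs_of_pos hcos]
    _ ≤ Real.tan m * Real.cos x := mul_le_mul_of_nonneg_right htan hcos.le

/-- Trigonometry of the cone: `|x| ≤ m ≤ π` gives `cos m ≤ cos x`. [folklore] -/
private theorem cos_le_cos_of_abs_le {x m : ℝ} (hx : |x| ≤ m) (hm : m ≤ π) : Real.cos m ≤ Real.cos x := by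
  rw [← Real.cos_abs x]
  exact Real.cos_le_cos_of_nonneg_of_le_pi (abs_nonneg x) hm hx

/-- The modulus of the weighted integrand: `‖χ·e^{F}‖ = χ·e^{Re F}` for `0 ≤ χ`. [folklore] -/
private theorem norm_mul_cexp {χ : ℝ} (hχ : 0 ≤ χ) (w : ℂ) : ‖(χ : ℂ) * cexp w‖ = χ * Real.exp w.re := by
  rw [norm_mul, Complex.norm_real, Real.norm_eq_abs, abs_of_nonneg hχ, Complex.norm_exp]

/-- The real part of the weighted integrand: `Re(χ·e^{F}) = χ·e^{Re F}·cos(Im F)`. [folklore] -/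
private theorem re_mul_cexp (χ : ℝ) (w : ℂ) : ((χ : ℂ) * cexp w).re = χ * Real.exp w.re * Real.cos w.im := by
  rw [Complex.re_ofReal_mul, Complex.exp_re, mul_assoc]

/-- The imaginary part of the weighted integrand: `Im(χ·e^{F}) = χ·e^{Re F}·sin(Im F)`. [folklore] -/
private theorem im_mul_cexp (χ : ℝ) (w : ℂ) : ((χ : ℂ) * cexp w).im = χ * Real.exp w.re * Real.sin w.im := by
  rw [Complex.im_ofReal_mul, Complex.exp_im, mul_assoc]

/-- The real shadow is integrable when the complex integrand is: `∫ χ e^{Re F} dμ` makes sense. [folklore] -/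
private theorem integrable_real_shadow {χ : Ω → ℝ} {F : Ω → ℂ} (h0 : ∀ ω, 0 ≤ χ ω)
    (hint : Integrable (fun ω => (χ ω : ℂ) * cexp (F ω)) μ) :
    Integrable (fun ω => χ ω * Real.exp (F ω).re) μ := by
  refine hint.norm.congr (Eventually.of_forall fun ω => ?_)
  exact norm_mul_cexp (h0 ω) (F ω)

/-- **CONE, MODULUS** — *«the integral above»* of (2.13) with a complexified exponent `F` (p. 266: the coupling made complex):
`‖∫ χ e^{F} dμ‖ ≤ ∫ χ e^{Re F} dμ`. [cite: Balaban1987RG1, (2.13) p.268 and p.266 (after (2.9))] -/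
theorem norm_integral_le_real {χ : Ω → ℝ} {F : Ω → ℂ} (h0 : ∀ ω, 0 ≤ χ ω) :
    ‖∫ ω, (χ ω : ℂ) * cexp (F ω) ∂μ‖ ≤ ∫ ω, χ ω * Real.exp (F ω).re ∂μ := by
  refine (norm_integral_le_integral_norm _).trans (le_of_eq ?_)
  refine integral_congr_ae (Eventually.of_forall fun ω => ?_)
  exact norm_mul_cexp (h0 ω) (F ω)

/-- **CONE, REAL PART** (the (2.13) integral with a complexified exponent): if `|Im F| ≤ m < π∕2` wherever `χ ≠ 0`, then
`cos m · ∫ χ e^{Re F} dμ ≤ Re ∫ χ e^{F} dμ`. [cite: Balaban1987RG1, (2.13) p.268 and p.266 (after (2.9))] -/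
theorem cos_mul_integral_le_re {χ : Ω → ℝ} {F : Ω → ℂ} {m : ℝ} (h0 : ∀ ω, 0 ≤ χ ω) (hm : m < π / 2)
    (hint : Integrable (fun ω => (χ ω : ℂ) * cexp (F ω)) μ) (him : ∀ ω, χ ω ≠ 0 → |(F ω).im| ≤ m) :
    Real.cos m * ∫ ω, χ ω * Real.exp (F ω).re ∂μ ≤ (∫ ω, (χ ω : ℂ) * cexp (F ω) ∂μ).re := by
  have hre : (∫ ω, (χ ω : ℂ) * cexp (F ω) ∂μ).re = ∫ ω, ((χ ω : ℂ) * cexp (F ω)).re ∂μ := by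
    have h := integral_re hint
    simp only [RCLike.re_to_complex] at h
    exact h.symm
  rw [hre, ← integral_const_mul]
  have hint1 : Integrable (fun ω => ((χ ω : ℂ) * cexp (F ω)).re) μ := by
    simpa only [RCLike.re_to_complex] using hint.re
  refine integral_mono ((integrable_real_shadow h0 hint).const_mul _) hint1 fun ω => ?_
  show Real.cos m * (χ ω * Real.exp (F ω).re) ≤ ((χ ω : ℂ) * cexp (F ω)).re
  rw [re_mul_cexp]
  by_cases hχ : χ ω = 0
  · simp [hχ]
  · have hc : Real.cos m ≤ Real.cos (F ω).im := cos_le_cos_of_abs_le (him ω hχ) (by linarith [Real.pi_pos])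
    have hpos : 0 ≤ χ ω * Real.exp (F ω).re := mul_nonneg (h0 ω) (Real.exp_pos _).le
    nlinarith

/-- **CONE, IMAGINARY PART** (the (2.13) integral with a complexified exponent): if `|Im F| ≤ m < π∕2` wherever `χ ≠ 0`, then
`|Im ∫ χ e^{F} dμ| ≤ tan m · Re ∫ χ e^{F} dμ` — the integral of sector-valued integrands stays in the (closed, convex) sector. [cite: Balaban1987RG1, (2.13) p.268 and p.266 (after (2.9))] -/
theorem abs_im_integral_le {χ : Ω → ℝ} {F : Ω → ℂ} {m : ℝ} (h0 : ∀ ω, 0 ≤ χ ω) (hm : m < π / 2)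
    (hint : Integrable (fun ω => (χ ω : ℂ) * cexp (F ω)) μ) (him : ∀ ω, χ ω ≠ 0 → |(F ω).im| ≤ m) :
    |(∫ ω, (χ ω : ℂ) * cexp (F ω) ∂μ).im| ≤ Real.tan m * (∫ ω, (χ ω : ℂ) * cexp (F ω) ∂μ).re := by
  have hre : (∫ ω, (χ ω : ℂ) * cexp (F ω) ∂μ).re = ∫ ω, ((χ ω : ℂ) * cexp (F ω)).re ∂μ := by
    have h := integral_re hint
    simp only [RCLike.re_to_complex] at h
    exact h.symm
  have himI : (∫ ω, (χ ω : ℂ) * cexp (F ω) ∂μ).im = ∫ ω, ((χ ω : ℂ) * cexp (F ω)).im ∂μ := by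
    have h := integral_im hint
    simp only [RCLike.im_to_complex] at h
    exact h.symm
  have hintre : Integrable (fun ω => ((χ ω : ℂ) * cexp (F ω)).re) μ := by
    simpa only [RCLike.re_to_complex] using hint.re
  have hintim : Integrable (fun ω => ((χ ω : ℂ) * cexp (F ω)).im) μ := by
    simpa only [RCLike.im_to_complex] using hint.im
  -- pointwise: `|Im(χe^{F})| ≤ tan m · Re(χe^{F})`
  have hpt : ∀ ω, |((χ ω : ℂ) * cexp (F ω)).im| ≤ Real.tan m * ((χ ω : ℂ) * cexp (F ω)).re := by
    intro ω
    rw [re_mul_cexp, im_mul_cexp]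
    by_cases hχ : χ ω = 0
    · simp [hχ]
    · have hpos : 0 ≤ χ ω * Real.exp (F ω).re := mul_nonneg (h0 ω) (Real.exp_pos _).le
      rw [abs_mul, abs_of_nonneg hpos]
      calc χ ω * Real.exp (F ω).re * |Real.sin (F ω).im|
          ≤ χ ω * Real.exp (F ω).re * (Real.tan m * Real.cos (F ω).im) :=
            mul_le_mul_of_nonneg_left (abs_sin_le_tan_mul_cos (him ω hχ) hm) hpos
        _ = Real.tan m * (χ ω * Real.exp (F ω).re * Real.cos (F ω).im) := by ring
  rw [hre, himI, ← integral_const_mul, abs_le]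
  refine ⟨?_, ?_⟩
  · rw [neg_le, ← integral_neg]
    refine integral_mono hintim.neg (hintre.const_mul _) fun ω => ?_
    show -((χ ω : ℂ) * cexp (F ω)).im ≤ Real.tan m * ((χ ω : ℂ) * cexp (F ω)).re
    exact (neg_le_abs _).trans (hpt ω)
  · refine integral_mono hintim (hintre.const_mul _) fun ω => ?_
    show ((χ ω : ℂ) * cexp (F ω)).im ≤ Real.tan m * ((χ ω : ℂ) * cexp (F ω)).re
    exact (le_abs_self _).trans (hpt ω)

/-- **CONE, POSITION** (the (2.13) integral with a complexified exponent): `|Im F| ≤ m < π∕2` on `{χ ≠ 0}` and a positive real shadow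
`∫ χ e^{Re F} dμ > 0` put the complex integral `∫ χ e^{F} dμ` in the open right half-plane (in particular in the slit plane, where the
new term `log ∫ …` of (2.13) is holomorphic). [cite: Balaban1987RG1, (2.13) p.268 and p.266 (after (2.9))] -/
theorem re_integral_pos {χ : Ω → ℝ} {F : Ω → ℂ} {m : ℝ} (h0 : ∀ ω, 0 ≤ χ ω) (hm : m < π / 2) (hm0 : 0 ≤ m)
    (hint : Integrable (fun ω => (χ ω : ℂ) * cexp (F ω)) μ) (him : ∀ ω, χ ω ≠ 0 → |(F ω).im| ≤ m)
    (hpos : 0 < ∫ ω, χ ω * Real.exp (F ω).re ∂μ) :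
    0 < (∫ ω, (χ ω : ℂ) * cexp (F ω) ∂μ).re := by
  have hc : 0 < Real.cos m := Real.cos_pos_of_mem_Ioo ⟨by linarith [Real.pi_pos], hm⟩
  exact (mul_pos hc hpos).trans_le (cos_mul_integral_le_re h0 hm hint him)

/-- **THE IMAGINARY-PART LETTER PASSES THROUGH THE LOGARITHM OF (2.13) WITH FACTOR ONE**: `|Im F| ≤ m < π∕2` on `{χ ≠ 0}` (`0 ≤ m`)
and a positive real shadow give `|Im log ∫ χ e^{F} dμ| = |arg ∫ χ e^{F} dμ| ≤ m` — the body-level reason the analyticity strip of the new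
term in an older coupling is the old action's (p. 266, *«analytic functions of the effective coupling constants»*). [cite: Balaban1987RG1, (2.13) p.268 and p.266 (after (2.9))] -/
theorem abs_im_clog_integral_le {χ : Ω → ℝ} {F : Ω → ℂ} {m : ℝ} (h0 : ∀ ω, 0 ≤ χ ω) (hm : m < π / 2) (hm0 : 0 ≤ m)
    (hint : Integrable (fun ω => (χ ω : ℂ) * cexp (F ω)) μ) (him : ∀ ω, χ ω ≠ 0 → |(F ω).im| ≤ m)
    (hpos : 0 < ∫ ω, χ ω * Real.exp (F ω).re ∂μ) :
    |(Complex.log (∫ ω, (χ ω : ℂ) * cexp (F ω) ∂μ)).im| ≤ m := by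
  set I : ℂ := ∫ ω, (χ ω : ℂ) * cexp (F ω) ∂μ with hI
  have hre : 0 < I.re := re_integral_pos h0 hm hm0 hint him hpos
  have himI : |I.im| ≤ Real.tan m * I.re := abs_im_integral_le h0 hm hint him
  rw [Complex.log_im]
  have harg : |Complex.arg I| < π / 2 := Complex.abs_arg_lt_pi_div_two_iff.2 (Or.inl hre)
  have hargI : Complex.arg I ∈ Ioo (-(π / 2)) (π / 2) := ⟨by linarith [(abs_lt.1 harg).1], (abs_lt.1 harg).2⟩
  have hmI : m ∈ Ioo (-(π / 2)) (π / 2) := ⟨by linarith, hm⟩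
  have hnmI : -m ∈ Ioo (-(π / 2)) (π / 2) := ⟨by linarith, by linarith⟩
  have htan : |Real.tan (Complex.arg I)| ≤ Real.tan m := by
    rw [Complex.tan_arg, abs_div, abs_of_pos hre, div_le_iff₀ hre]
    exact himI
  rw [abs_le]
  refine ⟨?_, ?_⟩
  · by_contra hlt
    have hlt : Complex.arg I < -m := lt_of_not_ge hlt
    have h := Real.strictMonoOn_tan hargI hnmI hlt
    rw [Real.tan_neg] at h
    linarith [(abs_le.1 htan).1]
  · by_contra hlt
    have hlt : m < Complex.arg I := lt_of_not_ge hlt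
    have h := Real.strictMonoOn_tan hmI hargI hlt
    linarith [(abs_le.1 htan).2]

/-- **CONE, THE REAL PART OF THE LOGARITHM OF (2.13), ABOVE**: `Re log ∫ χ e^{F} dμ ≤ log ∫ χ e^{Re F} dμ` (the complex integral
non-zero). [cite: Balaban1987RG1, (2.13) p.268 and p.266 (after (2.9))] -/
theorem re_clog_integral_le {χ : Ω → ℝ} {F : Ω → ℂ} (h0 : ∀ ω, 0 ≤ χ ω)
    (hne : (∫ ω, (χ ω : ℂ) * cexp (F ω) ∂μ) ≠ 0) :
    (Complex.log (∫ ω, (χ ω : ℂ) * cexp (F ω) ∂μ)).re ≤ Real.log (∫ ω, χ ω * Real.exp (F ω).re ∂μ) := by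
  rw [Complex.log_re]
  exact Real.log_le_log (norm_pos_iff.2 hne) (norm_integral_le_real h0)

/-- **CONE, THE REAL PART OF THE LOGARITHM OF (2.13), BELOW**: `log cos m + log ∫ χ e^{Re F} dμ ≤ Re log ∫ χ e^{F} dμ` when
`|Im F| ≤ m < π∕2` on `{χ ≠ 0}` (`0 ≤ m`) and the real shadow is positive — the modulus loses at most the factor `cos m`. [cite: Balaban1987RG1, (2.13) p.268 and p.266 (after (2.9))] -/
theorem le_re_clog_integral {χ : Ω → ℝ} {F : Ω → ℂ} {m : ℝ} (h0 : ∀ ω, 0 ≤ χ ω) (hm : m < π / 2) (hm0 : 0 ≤ m)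
    (hint : Integrable (fun ω => (χ ω : ℂ) * cexp (F ω)) μ) (him : ∀ ω, χ ω ≠ 0 → |(F ω).im| ≤ m)
    (hpos : 0 < ∫ ω, χ ω * Real.exp (F ω).re ∂μ) :
    Real.log (Real.cos m) + Real.log (∫ ω, χ ω * Real.exp (F ω).re ∂μ)
      ≤ (Complex.log (∫ ω, (χ ω : ℂ) * cexp (F ω) ∂μ)).re := by
  have hc : 0 < Real.cos m := Real.cos_pos_of_mem_Ioo ⟨by linarith [Real.pi_pos], hm⟩
  have hre := cos_mul_integral_le_re h0 hm hint him
  rw [Complex.log_re, ← Real.log_mul hc.ne' hpos.ne']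
  exact Real.log_le_log (mul_pos hc hpos) (hre.trans (Complex.re_le_norm _))

end Cone

/-! ## §2. The parametrised new term: holomorphy with the same imaginary-part letter -/

section Param

variable {Ω : Type*} [MeasurableSpace Ω] {μ : Measure Ω}

/-- Geometry of the strip: `‖z − Re z‖ = |Im z|`. [folklore] -/
private theorem norm_sub_re_eq (z : ℂ) : ‖z - (z.re : ℂ)‖ = |z.im| := by
  have h : z - (z.re : ℂ) = (z.im : ℂ) * I := by
    apply Complex.ext <;> simp
  rw [h, norm_mul, Complex.norm_I, mul_one, Complex.norm_real, Real.norm_eq_abs]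

/-- **VERTICAL MEAN VALUE**: a function holomorphic on an open convex `O` with `‖f′‖ ≤ Λ` there satisfies
`‖f z − f (Re z)‖ ≤ Λ·|Im z|` whenever `z, Re z ∈ O`. [folklore] -/
private theorem norm_sub_real_le {f : ℂ → ℂ} {O : Set ℂ} {Λ : ℝ} (hO : IsOpen O) (hOc : Convex ℝ O)
    (hf : DifferentiableOn ℂ f O) (hΛ : ∀ z ∈ O, ‖deriv f z‖ ≤ Λ) {z : ℂ} (hz : z ∈ O) (hzre : ((z.re : ℝ) : ℂ) ∈ O) :
    ‖f z - f (z.re : ℂ)‖ ≤ Λ * |z.im| := by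
  have h := hOc.norm_image_sub_le_of_norm_deriv_le (f := f)
    (fun _ hx => hf.differentiableAt (hO.mem_nhds hx)) hΛ hzre hz
  rwa [norm_sub_re_eq] at h

/-- **MEAN VALUE ON THE CONVEX NEIGHBOURHOOD**: `‖f z − f z₀‖ ≤ Λ·‖z − z₀‖` for `z, z₀ ∈ O`. [folklore] -/
private theorem norm_sub_le_of_deriv_le {f : ℂ → ℂ} {O : Set ℂ} {Λ : ℝ} (hO : IsOpen O) (hOc : Convex ℝ O)
    (hf : DifferentiableOn ℂ f O) (hΛ : ∀ z ∈ O, ‖deriv f z‖ ≤ Λ) {z z₀ : ℂ} (hz : z ∈ O) (hz₀ : z₀ ∈ O) :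
    ‖f z - f z₀‖ ≤ Λ * ‖z - z₀‖ :=
  hOc.norm_image_sub_le_of_norm_deriv_le (f := f) (fun _ hx => hf.differentiableAt (hO.mem_nhds hx)) hΛ hz₀ hz

/-- **DOMINATED HOLOMORPHY OF THE WEIGHTED INTEGRAL, PRODUCT-MEASURABLE FORM**: the complex integral
`z ↦ ∫ χ(ω) e^{Fc(z,ω)} dμ(ω)` has the derivative `∫ χ e^{Fc(z₀,·)} Fc′(z₀,·) dμ` at `z₀` under holomorphy of `Fc(·,ω)` on a ball (for
`ω` with `χ(ω) ≠ 0`), an integrable domination of `χ e^{Fc} Fc′` there, measurable integrands on the ball, an integrable integrand at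
`z₀`, and measurability of the PRODUCT `χ e^{Fc(z₀,·)} Fc′(z₀,·)` (twin of `B12Eq213AnalyticCoupling.hasDerivAt_cintegral`).
[cite: Balaban1987RG1, (2.13) p.268 and p.266 (after (2.9))] -/
theorem hasDerivAt_cintegral_prod {χ : Ω → ℝ} {Fc Fc' : ℂ → Ω → ℂ} {z₀ : ℂ} {ε : ℝ} (bound : Ω → ℝ) (hε : 0 < ε)
    (hmeas : ∀ z ∈ Metric.ball z₀ ε, AEStronglyMeasurable (fun ω => (χ ω : ℂ) * cexp (Fc z ω)) μ)
    (hint : Integrable (fun ω => (χ ω : ℂ) * cexp (Fc z₀ ω)) μ)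
    (hmeas' : AEStronglyMeasurable (fun ω => (χ ω : ℂ) * cexp (Fc z₀ ω) * Fc' z₀ ω) μ)
    (hdiff : ∀ ω, χ ω ≠ 0 → ∀ z ∈ Metric.ball z₀ ε, HasDerivAt (fun z => Fc z ω) (Fc' z ω) z)
    (hdom : ∀ ω, χ ω ≠ 0 → ∀ z ∈ Metric.ball z₀ ε, ‖(χ ω : ℂ) * cexp (Fc z ω) * Fc' z ω‖ ≤ bound ω)
    (hbound : Integrable bound μ) :
    HasDerivAt (fun z => ∫ ω, (χ ω : ℂ) * cexp (Fc z ω) ∂μ)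
      (∫ ω, (χ ω : ℂ) * cexp (Fc z₀ ω) * Fc' z₀ ω ∂μ) z₀ := by
  have hs : Metric.ball z₀ ε ∈ nhds z₀ := Metric.isOpen_ball.mem_nhds (Metric.mem_ball_self hε)
  have key := hasDerivAt_integral_of_dominated_loc_of_deriv_le (μ := μ)
    (F := fun z ω => (χ ω : ℂ) * cexp (Fc z ω)) (F' := fun z ω => (χ ω : ℂ) * cexp (Fc z ω) * Fc' z ω)
    (x₀ := z₀) (bound := fun ω => max (bound ω) 0) (s := Metric.ball z₀ ε) hs ?_ hint hmeas' ?_ hbound.pos_part ?_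
  · exact key.2
  · exact Filter.eventually_of_mem hs hmeas
  · refine Filter.Eventually.of_forall fun ω z hz => ?_
    by_cases hχ : χ ω = 0
    · simp [hχ]
    · exact (hdom ω hχ z hz).trans (le_max_left _ _)
  · refine Filter.Eventually.of_forall fun ω z hz => ?_
    by_cases hχ : χ ω = 0
    · have e0 : (fun z => (χ ω : ℂ) * cexp (Fc z ω)) = fun _ => 0 := by
        funext z; simp [hχ]
      rw [e0]
      simpa [hχ] using hasDerivAt_const z (0 : ℂ)
    · have h := ((hdiff ω hχ z hz).cexp).const_mul (χ ω : ℂ)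
      simpa [mul_assoc] using h

/-- **MEASURABILITY OF THE DERIVATIVE INTEGRAND FROM THAT OF THE BRACKETS**: if `G` and every `q_z`, `z` in a ball about `z₀`, are
a.e.-strongly measurable and `z ↦ q_z(ω)` is differentiable at `z₀` wherever `G(ω) ≠ 0`, then `G · ∂_z q_{z₀}` is a.e.-strongly
measurable (a sequential limit of difference quotients). [folklore] -/
private theorem aestronglyMeasurable_mul_deriv {G : Ω → ℂ} {q : ℂ → Ω → ℂ} {z₀ : ℂ} {δ : ℝ} (hδ : 0 < δ)
    (hG : AEStronglyMeasurable G μ) (hmeasE : ∀ z ∈ Metric.ball z₀ δ, AEStronglyMeasurable (fun ω => q z ω) μ)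
    (hq : ∀ ω, G ω ≠ 0 → DifferentiableAt ℂ (fun z => q z ω) z₀) :
    AEStronglyMeasurable (fun ω => G ω * deriv (fun z => q z ω) z₀) μ := by
  -- the real null sequence `t n = δ∕(n+2)`, read in `ℂ`
  set t : ℕ → ℂ := fun n => ((δ / ((n + 2 : ℕ) : ℝ) : ℝ) : ℂ) with ht
  have htpos : ∀ n, 0 < δ / ((n + 2 : ℕ) : ℝ) := fun n => by positivity
  have htne : ∀ n, t n ≠ 0 := fun n => by
    show ((δ / ((n + 2 : ℕ) : ℝ) : ℝ) : ℂ) ≠ 0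
    exact_mod_cast (htpos n).ne'
  have htball : ∀ n, z₀ + t n ∈ Metric.ball z₀ δ := fun n => by
    show z₀ + ((δ / ((n + 2 : ℕ) : ℝ) : ℝ) : ℂ) ∈ Metric.ball z₀ δ
    rw [Metric.mem_ball, dist_eq_norm, add_sub_cancel_left, Complex.norm_real, Real.norm_eq_abs,
      abs_of_pos (htpos n)]
    have h2 : (1 : ℝ) < ((n + 2 : ℕ) : ℝ) := by exact_mod_cast (by omega : 1 < n + 2)
    rw [div_lt_iff₀ (by positivity)]
    nlinarith
  have htlim : Tendsto t atTop (𝓝[≠] 0) := by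
    refine tendsto_nhdsWithin_iff.2 ⟨?_, Eventually.of_forall fun n => htne n⟩
    have h1 : Tendsto (fun n : ℕ => δ / ((n + 2 : ℕ) : ℝ)) atTop (𝓝 0) :=
      (tendsto_const_div_atTop_nhds_zero_nat δ).comp (tendsto_add_atTop_nat 2)
    have h2 := (Complex.continuous_ofReal.tendsto 0).comp h1
    rwa [Complex.ofReal_zero] at h2
  -- the difference quotients
  have hf : ∀ n, AEStronglyMeasurable (fun ω => G ω * ((t n)⁻¹ * (q (z₀ + t n) ω - q z₀ ω))) μ := fun n =>
    hG.mul ((((hmeasE _ (htball n)).sub (hmeasE z₀ (Metric.mem_ball_self hδ))).const_mul _))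
  refine aestronglyMeasurable_of_tendsto_ae atTop hf (Eventually.of_forall fun ω => ?_)
  by_cases hGω : G ω = 0
  · simp [hGω]
  · have hd := (hq ω hGω).hasDerivAt.tendsto_slope_zero
    have h := (hd.comp htlim).const_mul (G ω)
    simpa [Function.comp_def, smul_eq_mul] using h

/-- **INTEGRABILITY OF THE COMPLEXIFIED INTEGRAND FROM THE REAL ONE**: with the bracket `q_z` holomorphic on an open convex `O ∋ Re z`
with derivative letter `Λ` and real on real points (`q_t = q^ℝ_t`), wherever `χ ≠ 0`, the modulus of `χ e^{p + q_z}` is at most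
`e^{Λ|Im z|}·χ e^{p + q^ℝ_{Re z}}`; so the complex integrand is integrable when the real one at `Re z` is and it is measurable.
[cite: Balaban1987RG1, (2.13) p.268 and p.266 (after (2.9))] -/
theorem integrable_paramIntegrand {χ : Ω → ℝ} {p : Ω → ℝ} {q : ℂ → Ω → ℂ} {qr : ℝ → Ω → ℝ} {O : Set ℂ} {Λ : ℝ}
    (h0 : ∀ ω, 0 ≤ χ ω) (hO : IsOpen O) (hOc : Convex ℝ O)
    (hq_diff : ∀ ω, χ ω ≠ 0 → DifferentiableOn ℂ (fun z => q z ω) O)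
    (hq_deriv : ∀ ω, χ ω ≠ 0 → ∀ z ∈ O, ‖deriv (fun z => q z ω) z‖ ≤ Λ)
    (hq_real : ∀ ω, χ ω ≠ 0 → ∀ t : ℝ, (t : ℂ) ∈ O → q t ω = qr t ω)
    {z : ℂ} (hz : z ∈ O) (hzre : ((z.re : ℝ) : ℂ) ∈ O)
    (hmeasC : AEStronglyMeasurable (fun ω => (χ ω : ℂ) * cexp ((p ω : ℂ) + q z ω)) μ)
    (hint : Integrable (fun ω => χ ω * Real.exp (p ω + qr z.re ω)) μ) :
    Integrable (fun ω => (χ ω : ℂ) * cexp ((p ω : ℂ) + q z ω)) μ := by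
  refine Integrable.mono' (hint.const_mul (Real.exp (Λ * |z.im|))) hmeasC (Eventually.of_forall fun ω => ?_)
  rw [norm_mul_cexp (h0 ω)]
  by_cases hχ : χ ω = 0
  · simp [hχ]
  · have hdev : ‖q z ω - q (z.re : ℂ) ω‖ ≤ Λ * |z.im| := norm_sub_real_le hO hOc (hq_diff ω hχ) (hq_deriv ω hχ) hz hzre
    have hre : (q z ω).re ≤ qr z.re ω + Λ * |z.im| := by
      have h1 : (q z ω - q (z.re : ℂ) ω).re ≤ Λ * |z.im| := (Complex.re_le_norm _).trans hdev
      rw [Complex.sub_re, hq_real ω hχ z.re hzre, Complex.ofReal_re] at h1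
      linarith
    have hF : ((p ω : ℂ) + q z ω).re = p ω + (q z ω).re := by simp
    rw [hF]
    calc χ ω * Real.exp (p ω + (q z ω).re) ≤ χ ω * Real.exp (p ω + qr z.re ω + Λ * |z.im|) :=
          mul_le_mul_of_nonneg_left (Real.exp_le_exp.2 (by linarith)) (h0 ω)
      _ = Real.exp (Λ * |z.im|) * (χ ω * Real.exp (p ω + qr z.re ω)) := by rw [Real.exp_add]; ring

/-- **THE REAL SHADOW STAYS POSITIVE**: under the same letters, `e^{−Λ|Im z|}·∫ χ e^{p + q^ℝ_{Re z}} ≤ ∫ χ e^{Re(p + q_z)}`, so the real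
shadow of the complexified integrand is positive when the real integral at `Re z` is. [cite: Balaban1987RG1, (2.13) p.268] -/
theorem real_shadow_pos {χ : Ω → ℝ} {p : Ω → ℝ} {q : ℂ → Ω → ℂ} {qr : ℝ → Ω → ℝ} {O : Set ℂ} {Λ : ℝ}
    (h0 : ∀ ω, 0 ≤ χ ω) (hO : IsOpen O) (hOc : Convex ℝ O)
    (hq_diff : ∀ ω, χ ω ≠ 0 → DifferentiableOn ℂ (fun z => q z ω) O)
    (hq_deriv : ∀ ω, χ ω ≠ 0 → ∀ z ∈ O, ‖deriv (fun z => q z ω) z‖ ≤ Λ)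
    (hq_real : ∀ ω, χ ω ≠ 0 → ∀ t : ℝ, (t : ℂ) ∈ O → q t ω = qr t ω)
    {z : ℂ} (hz : z ∈ O) (hzre : ((z.re : ℝ) : ℂ) ∈ O)
    (hmeasC : AEStronglyMeasurable (fun ω => (χ ω : ℂ) * cexp ((p ω : ℂ) + q z ω)) μ)
    (hint : Integrable (fun ω => χ ω * Real.exp (p ω + qr z.re ω)) μ)
    (hpos : 0 < ∫ ω, χ ω * Real.exp (p ω + qr z.re ω) ∂μ) :
    0 < ∫ ω, χ ω * Real.exp (((p ω : ℂ) + q z ω).re) ∂μ := by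
  have hintC := integrable_paramIntegrand h0 hO hOc hq_diff hq_deriv hq_real hz hzre hmeasC hint
  have hsh := integrable_real_shadow h0 hintC
  have hle : Real.exp (-(Λ * |z.im|)) * ∫ ω, χ ω * Real.exp (p ω + qr z.re ω) ∂μ
      ≤ ∫ ω, χ ω * Real.exp (((p ω : ℂ) + q z ω).re) ∂μ := by
    rw [← integral_const_mul]
    refine integral_mono (hint.const_mul _) hsh fun ω => ?_
    show Real.exp (-(Λ * |z.im|)) * (χ ω * Real.exp (p ω + qr z.re ω)) ≤ χ ω * Real.exp (((p ω : ℂ) + q z ω).re)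
    by_cases hχ : χ ω = 0
    · simp [hχ]
    · have hdev : ‖q z ω - q (z.re : ℂ) ω‖ ≤ Λ * |z.im| :=
        norm_sub_real_le hO hOc (hq_diff ω hχ) (hq_deriv ω hχ) hz hzre
      have hre : qr z.re ω - Λ * |z.im| ≤ (q z ω).re := by
        have h1 : |(q z ω - q (z.re : ℂ) ω).re| ≤ Λ * |z.im| := (Complex.abs_re_le_norm _).trans hdev
        rw [Complex.sub_re, hq_real ω hχ z.re hzre, Complex.ofReal_re] at h1
        linarith [(abs_le.1 h1).1]
      have hF : ((p ω : ℂ) + q z ω).re = p ω + (q z ω).re := by simp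
      rw [hF]
      calc Real.exp (-(Λ * |z.im|)) * (χ ω * Real.exp (p ω + qr z.re ω))
          = χ ω * Real.exp (p ω + qr z.re ω - Λ * |z.im|) := by rw [sub_eq_add_neg, Real.exp_add _ (-(Λ * |z.im|))]; ring
        _ ≤ χ ω * Real.exp (p ω + (q z ω).re) := mul_le_mul_of_nonneg_left (Real.exp_le_exp.2 (by linarith)) (h0 ω)
  exact (mul_pos (Real.exp_pos _) hpos).trans_le hle

/-- **THE PARAMETRISED *«INTEGRAL ABOVE»* IS HOLOMORPHIC IN THE OLDER COUPLING**: `J(z) = ∫ χ e^{p + q_z} dμ` — real base exponent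
`p` (print's `𝐏^{(k)}` at the real last coupling), complex bracket `q_z` (the old action at the fluctuated field with one older coupling
complexified) holomorphic in `z` on an open convex `O` (closed under `z ↦ Re z`) wherever `χ ≠ 0`, derivative letter `Λ`, real on real
points where the real integrands are integrable, the brackets and the integrands measurable — has at every `z₀ ∈ O` the derivative
`∫ χ e^{p + q_{z₀}}·∂_z q_{z₀} dμ`. [cite: Balaban1987RG1, (2.13) p.268, p.266 (after (2.9)) and §0 (0.23) p.256] -/
theorem hasDerivAt_paramIntegral {χ : Ω → ℝ} {p : Ω → ℝ} {q : ℂ → Ω → ℂ} {qr : ℝ → Ω → ℝ} {O : Set ℂ} {Λ : ℝ}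
    (h0 : ∀ ω, 0 ≤ χ ω) (hO : IsOpen O) (hOc : Convex ℝ O) (hOre : ∀ z ∈ O, ((z.re : ℝ) : ℂ) ∈ O) (hΛ : 0 ≤ Λ)
    (hq_diff : ∀ ω, χ ω ≠ 0 → DifferentiableOn ℂ (fun z => q z ω) O)
    (hq_deriv : ∀ ω, χ ω ≠ 0 → ∀ z ∈ O, ‖deriv (fun z => q z ω) z‖ ≤ Λ)
    (hq_real : ∀ ω, χ ω ≠ 0 → ∀ t : ℝ, (t : ℂ) ∈ O → q t ω = qr t ω)
    (hmeasC : ∀ z ∈ O, AEStronglyMeasurable (fun ω => (χ ω : ℂ) * cexp ((p ω : ℂ) + q z ω)) μ)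
    (hmeasE : ∀ z ∈ O, AEStronglyMeasurable (fun ω => q z ω) μ)
    (hint : ∀ t : ℝ, (t : ℂ) ∈ O → Integrable (fun ω => χ ω * Real.exp (p ω + qr t ω)) μ)
    {z₀ : ℂ} (hz₀ : z₀ ∈ O) :
    HasDerivAt (fun z => ∫ ω, (χ ω : ℂ) * cexp ((p ω : ℂ) + q z ω) ∂μ)
      (∫ ω, (χ ω : ℂ) * cexp ((p ω : ℂ) + q z₀ ω) * deriv (fun z => q z ω) z₀ ∂μ) z₀ := by
  obtain ⟨δ, hδ, hball⟩ := Metric.isOpen_iff.1 hO z₀ hz₀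
  have hintz₀ : Integrable (fun ω => (χ ω : ℂ) * cexp ((p ω : ℂ) + q z₀ ω)) μ :=
    integrable_paramIntegrand h0 hO hOc hq_diff hq_deriv hq_real hz₀ (hOre z₀ hz₀) (hmeasC z₀ hz₀) (hint _ (hOre z₀ hz₀))
  have hsh := integrable_real_shadow h0 hintz₀
  refine hasDerivAt_cintegral_prod (Fc := fun z ω => (p ω : ℂ) + q z ω) (Fc' := fun z ω => deriv (fun z => q z ω) z)
    (fun ω => Λ * Real.exp (Λ * δ) * (χ ω * Real.exp (((p ω : ℂ) + q z₀ ω).re))) hδ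
    (fun z hz => hmeasC z (hball hz)) hintz₀ ?_ ?_ ?_ ((hsh.const_mul _))
  · -- measurability of the product via difference quotients
    refine aestronglyMeasurable_mul_deriv hδ hintz₀.aestronglyMeasurable (fun z hz => hmeasE z (hball hz)) fun ω hG => ?_
    have hχ : χ ω ≠ 0 := by
      intro h; apply hG; simp [h]
    exact (hq_diff ω hχ).differentiableAt (hO.mem_nhds hz₀)
  · intro ω hχ z hz
    exact ((hq_diff ω hχ).differentiableAt (hO.mem_nhds (hball hz))).hasDerivAt.const_add _
  · intro ω hχ z hz
    have hzO : z ∈ O := hball hz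
    have hdz : ‖z - z₀‖ < δ := by rwa [Metric.mem_ball, dist_eq_norm] at hz
    have hdev : ‖q z ω - q z₀ ω‖ ≤ Λ * ‖z - z₀‖ := norm_sub_le_of_deriv_le hO hOc (hq_diff ω hχ) (hq_deriv ω hχ) hzO hz₀
    have hre : (q z ω).re ≤ (q z₀ ω).re + Λ * δ := by
      have h1 : (q z ω - q z₀ ω).re ≤ Λ * ‖z - z₀‖ := (Complex.re_le_norm _).trans hdev
      rw [Complex.sub_re] at h1
      nlinarith [mul_le_mul_of_nonneg_left hdz.le hΛ]
    rw [norm_mul, norm_mul_cexp (h0 ω)]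
    have hF : ((p ω : ℂ) + q z ω).re = p ω + (q z ω).re := by simp
    have hF₀ : ((p ω : ℂ) + q z₀ ω).re = p ω + (q z₀ ω).re := by simp
    rw [hF, hF₀]
    have hpos : 0 ≤ χ ω * Real.exp (p ω + (q z ω).re) := mul_nonneg (h0 ω) (Real.exp_pos _).le
    calc χ ω * Real.exp (p ω + (q z ω).re) * ‖deriv (fun z => q z ω) z‖
        ≤ χ ω * Real.exp (p ω + (q z ω).re) * Λ := mul_le_mul_of_nonneg_left (hq_deriv ω hχ z hzO) hpos
      _ ≤ χ ω * Real.exp (p ω + (q z₀ ω).re + Λ * δ) * Λ :=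
          mul_le_mul_of_nonneg_right (mul_le_mul_of_nonneg_left (Real.exp_le_exp.2 (by linarith)) (h0 ω)) hΛ
      _ = Λ * Real.exp (Λ * δ) * (χ ω * Real.exp (p ω + (q z₀ ω).re)) := by rw [Real.exp_add]; ring

/-- **THE DERIVATIVE OF THE PARAMETRISED INTEGRAL IS A `Λ`-BOUNDED WEIGHTED INTEGRAL**: `‖∫ χ e^{p + q_z}·∂_z q_z dμ‖ ≤ Λ·∫ χ e^{Re(p + q_z)} dμ`.
[cite: Balaban1987RG1, (2.13) p.268] -/
theorem norm_derivIntegral_le {χ : Ω → ℝ} {p : Ω → ℝ} {q : ℂ → Ω → ℂ} {O : Set ℂ} {Λ : ℝ} (h0 : ∀ ω, 0 ≤ χ ω)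
    (hq_deriv : ∀ ω, χ ω ≠ 0 → ∀ z ∈ O, ‖deriv (fun z => q z ω) z‖ ≤ Λ) {z : ℂ} (hz : z ∈ O)
    (hintC : Integrable (fun ω => (χ ω : ℂ) * cexp ((p ω : ℂ) + q z ω)) μ) :
    ‖∫ ω, (χ ω : ℂ) * cexp ((p ω : ℂ) + q z ω) * deriv (fun z => q z ω) z ∂μ‖
      ≤ Λ * ∫ ω, χ ω * Real.exp (((p ω : ℂ) + q z ω).re) ∂μ := by
  rw [← integral_const_mul]
  refine norm_integral_le_of_norm_le ((integrable_real_shadow h0 hintC).const_mul _) (Eventually.of_forall fun ω => ?_)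
  rw [norm_mul, norm_mul_cexp (h0 ω)]
  by_cases hχ : χ ω = 0
  · simp [hχ]
  · have hpos : 0 ≤ χ ω * Real.exp (((p ω : ℂ) + q z ω).re) := mul_nonneg (h0 ω) (Real.exp_pos _).le
    calc χ ω * Real.exp (((p ω : ℂ) + q z ω).re) * ‖deriv (fun z => q z ω) z‖
        ≤ χ ω * Real.exp (((p ω : ℂ) + q z ω).re) * Λ := mul_le_mul_of_nonneg_left (hq_deriv ω hχ z hz) hpos
      _ = Λ * (χ ω * Real.exp (((p ω : ℂ) + q z ω).re)) := by ring

/-- **ON REAL POINTS THE PARAMETRISED INTEGRAL IS THE REAL ONE**: `J(t) = ∫ χ e^{p + q^ℝ_t} dμ` for real `t` with `↑t ∈ O`.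
[cite: Balaban1987RG1, (2.13) p.268] -/
theorem paramIntegral_ofReal {χ : Ω → ℝ} {p : Ω → ℝ} {q : ℂ → Ω → ℂ} {qr : ℝ → Ω → ℝ} {O : Set ℂ}
    (hq_real : ∀ ω, χ ω ≠ 0 → ∀ t : ℝ, (t : ℂ) ∈ O → q t ω = qr t ω) {t : ℝ} (ht : (t : ℂ) ∈ O) :
    ∫ ω, (χ ω : ℂ) * cexp ((p ω : ℂ) + q t ω) ∂μ = ((∫ ω, χ ω * Real.exp (p ω + qr t ω) ∂μ : ℝ) : ℂ) := by
  rw [← integral_complex_ofReal]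
  refine integral_congr_ae (Eventually.of_forall fun ω => ?_)
  show (χ ω : ℂ) * cexp ((p ω : ℂ) + q t ω) = ((χ ω * Real.exp (p ω + qr t ω) : ℝ) : ℂ)
  by_cases hχ : χ ω = 0
  · simp [hχ]
  · rw [hq_real ω hχ t ht, ← Complex.ofReal_add, ← Complex.ofReal_exp, ← Complex.ofReal_mul]

/-- **THE NEW TERM IN A COMPLEXIFIED OLDER COUPLING — ALL THE LETTERS.**  Under the hypotheses of `hasDerivAt_paramIntegral` plus
the imaginary-part letter `|Im q_z| ≤ m` (`0 ≤ m < π∕2`) wherever `χ ≠ 0` and positive real integrals, at every `z₀ ∈ O` the new term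
`z ↦ log ∫ χ e^{p + q_z} dμ` (principal logarithm): (i) has the derivative `J′(z₀)∕J(z₀)`; (ii) **its derivative letter is `Λ ∕ cos m`**;
(iii) **its imaginary-part letter is `m` — UNCHANGED**; and the integral `J(z₀)` has positive real part.  Print's *«analytic functions of
the effective coupling constants»* (p. 266) for an OLDER constant, one renormalization step, on the body. [cite: Balaban1987RG1, p.266 (after (2.9)), (2.13) p.268 and p.263 (clause before (1.18))] -/
theorem clog_paramIntegral_letters {χ : Ω → ℝ} {p : Ω → ℝ} {q : ℂ → Ω → ℂ} {qr : ℝ → Ω → ℝ} {O : Set ℂ} {Λ m : ℝ}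
    (h0 : ∀ ω, 0 ≤ χ ω) (hO : IsOpen O) (hOc : Convex ℝ O) (hOre : ∀ z ∈ O, ((z.re : ℝ) : ℂ) ∈ O) (hΛ : 0 ≤ Λ)
    (hm0 : 0 ≤ m) (hm : m < π / 2)
    (hq_diff : ∀ ω, χ ω ≠ 0 → DifferentiableOn ℂ (fun z => q z ω) O)
    (hq_im : ∀ ω, χ ω ≠ 0 → ∀ z ∈ O, |(q z ω).im| ≤ m)
    (hq_deriv : ∀ ω, χ ω ≠ 0 → ∀ z ∈ O, ‖deriv (fun z => q z ω) z‖ ≤ Λ)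
    (hq_real : ∀ ω, χ ω ≠ 0 → ∀ t : ℝ, (t : ℂ) ∈ O → q t ω = qr t ω)
    (hmeasC : ∀ z ∈ O, AEStronglyMeasurable (fun ω => (χ ω : ℂ) * cexp ((p ω : ℂ) + q z ω)) μ)
    (hmeasE : ∀ z ∈ O, AEStronglyMeasurable (fun ω => q z ω) μ)
    (hint : ∀ t : ℝ, (t : ℂ) ∈ O → Integrable (fun ω => χ ω * Real.exp (p ω + qr t ω)) μ)
    (hpos : ∀ t : ℝ, (t : ℂ) ∈ O → 0 < ∫ ω, χ ω * Real.exp (p ω + qr t ω) ∂μ)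
    {z₀ : ℂ} (hz₀ : z₀ ∈ O) :
    0 < (∫ ω, (χ ω : ℂ) * cexp ((p ω : ℂ) + q z₀ ω) ∂μ).re ∧
    HasDerivAt (fun z => Complex.log (∫ ω, (χ ω : ℂ) * cexp ((p ω : ℂ) + q z ω) ∂μ))
      ((∫ ω, (χ ω : ℂ) * cexp ((p ω : ℂ) + q z₀ ω) * deriv (fun z => q z ω) z₀ ∂μ) /
        (∫ ω, (χ ω : ℂ) * cexp ((p ω : ℂ) + q z₀ ω) ∂μ)) z₀ ∧
    ‖(∫ ω, (χ ω : ℂ) * cexp ((p ω : ℂ) + q z₀ ω) * deriv (fun z => q z ω) z₀ ∂μ) /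
        (∫ ω, (χ ω : ℂ) * cexp ((p ω : ℂ) + q z₀ ω) ∂μ)‖ ≤ Λ / Real.cos m ∧
    |(Complex.log (∫ ω, (χ ω : ℂ) * cexp ((p ω : ℂ) + q z₀ ω) ∂μ)).im| ≤ m := by
  have hintC := integrable_paramIntegrand h0 hO hOc hq_diff hq_deriv hq_real hz₀ (hOre z₀ hz₀) (hmeasC z₀ hz₀)
    (hint _ (hOre z₀ hz₀))
  have hshpos := real_shadow_pos h0 hO hOc hq_diff hq_deriv hq_real hz₀ (hOre z₀ hz₀) (hmeasC z₀ hz₀)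
    (hint _ (hOre z₀ hz₀)) (hpos _ (hOre z₀ hz₀))
  have him : ∀ ω, χ ω ≠ 0 → |((p ω : ℂ) + q z₀ ω).im| ≤ m := fun ω hχ => by
    simpa using hq_im ω hχ z₀ hz₀
  have hRe : 0 < (∫ ω, (χ ω : ℂ) * cexp ((p ω : ℂ) + q z₀ ω) ∂μ).re := re_integral_pos h0 hm hm0 hintC him hshpos
  have hslit : (∫ ω, (χ ω : ℂ) * cexp ((p ω : ℂ) + q z₀ ω) ∂μ) ∈ Complex.slitPlane :=
    Complex.mem_slitPlane_iff.2 (Or.inl hRe)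
  have hJ := hasDerivAt_paramIntegral h0 hO hOc hOre hΛ hq_diff hq_deriv hq_real hmeasC hmeasE hint hz₀
  have hc : 0 < Real.cos m := Real.cos_pos_of_mem_Ioo ⟨by linarith [Real.pi_pos], hm⟩
  refine ⟨hRe, hJ.clog hslit, ?_, abs_im_clog_integral_le h0 hm hm0 hintC him hshpos⟩
  -- the derivative letter `Λ ∕ cos m`
  have hnum := norm_derivIntegral_le (p := p) h0 hq_deriv hz₀ hintC
  have hden : Real.cos m * ∫ ω, χ ω * Real.exp (((p ω : ℂ) + q z₀ ω).re) ∂μ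
      ≤ ‖∫ ω, (χ ω : ℂ) * cexp ((p ω : ℂ) + q z₀ ω) ∂μ‖ :=
    (cos_mul_integral_le_re h0 hm hintC him).trans (Complex.re_le_norm _)
  rw [norm_div]
  calc ‖∫ ω, (χ ω : ℂ) * cexp ((p ω : ℂ) + q z₀ ω) * deriv (fun z => q z ω) z₀ ∂μ‖ /
        ‖∫ ω, (χ ω : ℂ) * cexp ((p ω : ℂ) + q z₀ ω) ∂μ‖
      ≤ (Λ * ∫ ω, χ ω * Real.exp (((p ω : ℂ) + q z₀ ω).re) ∂μ) /
        (Real.cos m * ∫ ω, χ ω * Real.exp (((p ω : ℂ) + q z₀ ω).re) ∂μ) :=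
        div_le_div₀ (mul_nonneg hΛ hshpos.le) hnum (mul_pos hc hshpos) hden
    _ = Λ / Real.cos m := by rw [mul_div_mul_right _ _ hshpos.ne']

end Param

/-! ## §3. The analytic history tower with a fixed strip -/

section Tower

variable {Y : Type*}

/-- **ONE RENORMALIZATION STEP IN A COMPLEXIFIED OLDER COUPLING, ON THE BODY.**  Step datum `D` (print's `dμ_{C^{(k)}(U)}`, `χ_k`,
`𝐏^{(k)}`), the bracket's configuration map `τ` read at the REAL last coupling `a = g_k` (print's `U_k(exp i[g_kCB − hD̃(g_kCB)]V^{(k)})`),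
the history-free remainder `c = R_k(g_k, U)`, the small-field domain `S = Dom k` with `τ(a, U, B) ∈ S` on the support of `χ_U`; the old
action as a family `Ec_z : Y → ℂ` in the complexified older coupling `z ∈ O` (open, convex, closed under `z ↦ Re z`) with, on `S`:
holomorphy on `O`, imaginary-part letter `m` (`0 ≤ m < π∕2`), derivative letter `Λ`, and `Ec_t = E^ℝ_t` on real points; measurable
integrands and brackets; the REAL integrands integrable with positive integrals.  Then the new complex action
`N(z) = log ∫ χ_U e^{𝐏(a,U,B) + Ec_z(τ(a,U,B))} dμ_U + c` is holomorphic on the SAME `O`, has **the same imaginary-part letter `m`**, the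
derivative letter `Λ ∕ cos m`, and equals the real new action `newTerm {D with Q := E^ℝ_t ∘ τ} a U + c` on real points.
[cite: Balaban1987RG1, (2.13) p.268, p.266 (after (2.9)), p.263 (clause before (1.18)) and §0 (0.23) p.256] -/
theorem analyticHistory_step (D : FluctData Y) (τ : ℝ → Y → D.𝓑 → Y) (Ec : ℂ → Y → ℂ) (Er : ℝ → Y → ℝ) (S : Set Y)
    (O : Set ℂ) {m Λ : ℝ} (a c : ℝ) (U : Y)
    (hO : IsOpen O) (hOc : Convex ℝ O) (hOre : ∀ z ∈ O, ((z.re : ℝ) : ℂ) ∈ O) (hΛ : 0 ≤ Λ) (hm0 : 0 ≤ m) (hm : m < π / 2)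
    (hS : ∀ B, D.χ U B ≠ 0 → τ a U B ∈ S)
    (hEc_diff : ∀ y ∈ S, DifferentiableOn ℂ (fun z => Ec z y) O)
    (hEc_im : ∀ y ∈ S, ∀ z ∈ O, |(Ec z y).im| ≤ m)
    (hEc_deriv : ∀ y ∈ S, ∀ z ∈ O, ‖deriv (fun z => Ec z y) z‖ ≤ Λ)
    (hEc_real : ∀ y ∈ S, ∀ t : ℝ, (t : ℂ) ∈ O → Ec t y = Er t y)
    (hmeasC : ∀ z ∈ O, AEStronglyMeasurable (fun B => (D.χ U B : ℂ) * cexp ((D.P a U B : ℂ) + Ec z (τ a U B))) (D.μ U))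
    (hmeasE : ∀ z ∈ O, AEStronglyMeasurable (fun B => Ec z (τ a U B)) (D.μ U))
    (hint : ∀ t : ℝ, (t : ℂ) ∈ O → Integrable (FluctData.integrand { D with Q := fun a U B => Er t (τ a U B) } a U) (D.μ U))
    (hpos : ∀ t : ℝ, (t : ℂ) ∈ O → 0 < FluctData.integral { D with Q := fun a U B => Er t (τ a U B) } a U) :
    DifferentiableOn ℂ (fun z => Complex.log (∫ B, (D.χ U B : ℂ) * cexp ((D.P a U B : ℂ) + Ec z (τ a U B)) ∂(D.μ U)) + (c : ℂ)) O ∧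
    (∀ z ∈ O, |(Complex.log (∫ B, (D.χ U B : ℂ) * cexp ((D.P a U B : ℂ) + Ec z (τ a U B)) ∂(D.μ U)) + (c : ℂ)).im| ≤ m) ∧
    (∀ z ∈ O, ‖deriv (fun z => Complex.log (∫ B, (D.χ U B : ℂ) * cexp ((D.P a U B : ℂ) + Ec z (τ a U B)) ∂(D.μ U)) + (c : ℂ)) z‖
      ≤ Λ / Real.cos m) ∧
    (∀ t : ℝ, (t : ℂ) ∈ O → Complex.log (∫ B, (D.χ U B : ℂ) * cexp ((D.P a U B : ℂ) + Ec t (τ a U B)) ∂(D.μ U)) + (c : ℂ)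
      = ((FluctData.newTerm { D with Q := fun a U B => Er t (τ a U B) } a U + c : ℝ) : ℂ)) := by
  -- the hypotheses of §2 at `Ω := 𝓑`, `χ := χ_U`, `p := 𝐏(a,U,·)`, `q_z := Ec_z ∘ τ(a,U,·)`, `q^ℝ_t := E^ℝ_t ∘ τ(a,U,·)`
  have h0 : ∀ B, 0 ≤ D.χ U B := D.χ_nonneg U
  have hq_diff : ∀ B, D.χ U B ≠ 0 → DifferentiableOn ℂ (fun z => Ec z (τ a U B)) O := fun B hB => hEc_diff _ (hS B hB)
  have hq_im : ∀ B, D.χ U B ≠ 0 → ∀ z ∈ O, |(Ec z (τ a U B)).im| ≤ m := fun B hB => hEc_im _ (hS B hB)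
  have hq_deriv : ∀ B, D.χ U B ≠ 0 → ∀ z ∈ O, ‖deriv (fun z => Ec z (τ a U B)) z‖ ≤ Λ :=
    fun B hB => hEc_deriv _ (hS B hB)
  have hq_real : ∀ B, D.χ U B ≠ 0 → ∀ t : ℝ, (t : ℂ) ∈ O → Ec t (τ a U B) = ((Er t (τ a U B) : ℝ) : ℂ) :=
    fun B hB => hEc_real _ (hS B hB)
  have hint' : ∀ t : ℝ, (t : ℂ) ∈ O → Integrable (fun B => D.χ U B * Real.exp (D.P a U B + Er t (τ a U B))) (D.μ U) :=
    fun t ht => hint t ht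
  have hpos' : ∀ t : ℝ, (t : ℂ) ∈ O → 0 < ∫ B, D.χ U B * Real.exp (D.P a U B + Er t (τ a U B)) ∂(D.μ U) :=
    fun t ht => hpos t ht
  have key : ∀ z₀ ∈ O, _ := fun z₀ hz₀ =>
    clog_paramIntegral_letters (μ := D.μ U) (χ := D.χ U) (p := D.P a U) (q := fun z B => Ec z (τ a U B))
      (qr := fun t B => Er t (τ a U B)) h0 hO hOc hOre hΛ hm0 hm hq_diff hq_im hq_deriv hq_real hmeasC hmeasE hint' hpos' hz₀
  refine ⟨?_, ?_, ?_, ?_⟩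
  · intro z hz
    exact ((key z hz).2.1.differentiableAt.add_const (c : ℂ)).differentiableWithinAt
  · intro z hz
    rw [Complex.add_im, Complex.ofReal_im, add_zero]
    exact (key z hz).2.2.2
  · intro z hz
    rw [deriv_add_const, (key z hz).2.1.deriv]
    exact (key z hz).2.2.1
  · intro t ht
    have hI := paramIntegral_ofReal (μ := D.μ U) (χ := D.χ U) (p := D.P a U) (q := fun z B => Ec z (τ a U B))
      (qr := fun t B => Er t (τ a U B)) hq_real ht
    have hIeq : (∫ B, D.χ U B * Real.exp (D.P a U B + Er t (τ a U B)) ∂(D.μ U))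
        = FluctData.integral { D with Q := fun a U B => Er t (τ a U B) } a U := rfl
    rw [hI, hIeq, ← Complex.ofReal_log (FluctData.integral_nonneg _ a U), FluctData.newTerm]
    push_cast
    ring

/-- **THE ANALYTIC HISTORY TOWER WITH A FIXED STRIP — [Balaban1987RG1] p. 266 *«𝐄^{(j)} … are analytic functions of the effective
coupling constants»* FOR AN OLDER CONSTANT `g_i`, ON THE BODY, ALL AGES.**  Per step `k`: the datum `D k`, the bracket map `τ k`, the
remainder `R k`, the domains `Dom k` (compatible: `τ k (g k) U B ∈ Dom k` on the support of `χ_U` for `U ∈ Dom (k+1)`); a real history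
`g`, an older index `i`, an open convex `O ⊆ ℂ` closed under `z ↦ Re z`; the real actions `E k h` under the un-subtracted recursion
(`B12Eq213HistoryTowerSharp` §2) for the histories `g with g_i := t`, `↑t ∈ O`, above level `i`; the complexified actions `Ec k z` under
the complex recursion `Ec (k+1) z U = log ∫ χ_U e^{𝐏_k(g_k,U,B) + Ec k z (τ k (g k) U B)} dμ_U + R k (g k) U`; measurable integrands and
brackets; the real integrands integrable with positive integrals (all DISPLAYED, as in the whole chain).  FROM THE BIRTH LETTER at level
`i + 1` — holomorphy on `O`, imaginary-part letter `m` (`0 ≤ m < π∕2`), derivative letter `Λ₀ ≥ 0`, real compatibility (the shape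
`B12Eq213AnalyticCoupling` concludes for the last coupling) — FOR EVERY `k > i` AND `U ∈ Dom k`: `z ↦ Ec k z U` is holomorphic on the
SAME `O`; **`|Im Ec k z U| ≤ m` — the strip never shrinks with the age**; `‖∂_z Ec k z U‖ ≤ Λ₀ ∕ (cos m)^{k−1−i}` (geometric in the age);
`Ec k t U = E k (g with g_i := t) U` on real points. [cite: Balaban1987RG1, p.266 (after (2.9)), §0 (0.23) p.256, (2.11)–(2.13) pp.267–268 and p.263 (clause before (1.18))] -/
theorem analyticHistory_letters (D : ℕ → FluctData Y) (τ : (k : ℕ) → ℝ → Y → (D k).𝓑 → Y) (R : ℕ → ℝ → Y → ℝ)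
    (E : ℕ → (ℕ → ℝ) → Y → ℝ) (Ec : ℕ → ℂ → Y → ℂ) (Dom : ℕ → Set Y) (O : Set ℂ) {m Λ₀ : ℝ} (g : ℕ → ℝ) (i : ℕ)
    (hO : IsOpen O) (hOc : Convex ℝ O) (hOre : ∀ z ∈ O, ((z.re : ℝ) : ℂ) ∈ O) (hΛ₀ : 0 ≤ Λ₀) (hm0 : 0 ≤ m) (hm : m < π / 2)
    (hrec : ∀ t : ℝ, (t : ℂ) ∈ O → ∀ k, i < k → ∀ U ∈ Dom (k + 1),
      E (k + 1) (Function.update g i t) U =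
        FluctData.newTerm { D k with Q := fun a U B => E k (Function.update g i t) (τ k a U B) } (g k) U + R k (g k) U)
    (hrecC : ∀ k, i < k → ∀ z ∈ O, ∀ U ∈ Dom (k + 1),
      Ec (k + 1) z U = Complex.log (∫ B, ((D k).χ U B : ℂ) * cexp (((D k).P (g k) U B : ℂ) + Ec k z (τ k (g k) U B)) ∂((D k).μ U))
        + (R k (g k) U : ℂ))
    (hτ : ∀ k, ∀ U ∈ Dom (k + 1), ∀ B, (D k).χ U B ≠ 0 → τ k (g k) U B ∈ Dom k)
    (hmeasC : ∀ k, i < k → ∀ U ∈ Dom (k + 1), ∀ z ∈ O,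
      AEStronglyMeasurable (fun B => ((D k).χ U B : ℂ) * cexp (((D k).P (g k) U B : ℂ) + Ec k z (τ k (g k) U B))) ((D k).μ U))
    (hmeasE : ∀ k, i < k → ∀ U ∈ Dom (k + 1), ∀ z ∈ O, AEStronglyMeasurable (fun B => Ec k z (τ k (g k) U B)) ((D k).μ U))
    (hint : ∀ t : ℝ, (t : ℂ) ∈ O → ∀ k, i < k → ∀ U ∈ Dom (k + 1),
      Integrable (FluctData.integrand { D k with Q := fun a U B => E k (Function.update g i t) (τ k a U B) } (g k) U) ((D k).μ U))
    (hpos : ∀ t : ℝ, (t : ℂ) ∈ O → ∀ k, i < k → ∀ U ∈ Dom (k + 1),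
      0 < FluctData.integral { D k with Q := fun a U B => E k (Function.update g i t) (τ k a U B) } (g k) U)
    (hb_diff : ∀ U ∈ Dom (i + 1), DifferentiableOn ℂ (fun z => Ec (i + 1) z U) O)
    (hb_im : ∀ U ∈ Dom (i + 1), ∀ z ∈ O, |(Ec (i + 1) z U).im| ≤ m)
    (hb_deriv : ∀ U ∈ Dom (i + 1), ∀ z ∈ O, ‖deriv (fun z => Ec (i + 1) z U) z‖ ≤ Λ₀)
    (hb_real : ∀ U ∈ Dom (i + 1), ∀ t : ℝ, (t : ℂ) ∈ O → Ec (i + 1) t U = E (i + 1) (Function.update g i t) U) :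
    ∀ k, i < k → ∀ U ∈ Dom k,
      DifferentiableOn ℂ (fun z => Ec k z U) O ∧
      (∀ z ∈ O, |(Ec k z U).im| ≤ m) ∧
      (∀ z ∈ O, ‖deriv (fun z => Ec k z U) z‖ ≤ Λ₀ / Real.cos m ^ (k - (i + 1))) ∧
      (∀ t : ℝ, (t : ℂ) ∈ O → Ec k t U = E k (Function.update g i t) U) := by
  have hc : 0 < Real.cos m := Real.cos_pos_of_mem_Ioo ⟨by linarith [Real.pi_pos], hm⟩
  -- induction on the age `n = k − (i+1)`
  have main : ∀ n : ℕ, ∀ U ∈ Dom (i + 1 + n),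
      DifferentiableOn ℂ (fun z => Ec (i + 1 + n) z U) O ∧
      (∀ z ∈ O, |(Ec (i + 1 + n) z U).im| ≤ m) ∧
      (∀ z ∈ O, ‖deriv (fun z => Ec (i + 1 + n) z U) z‖ ≤ Λ₀ / Real.cos m ^ n) ∧
      (∀ t : ℝ, (t : ℂ) ∈ O → Ec (i + 1 + n) t U = E (i + 1 + n) (Function.update g i t) U) := by
    intro n
    induction n with
    | zero =>
      intro U hU
      simp only [Nat.add_zero, pow_zero, div_one] at hU ⊢
      exact ⟨hb_diff U hU, hb_im U hU, hb_deriv U hU, hb_real U hU⟩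
    | succ n ih =>
      intro U hU
      have e : i + 1 + (n + 1) = (i + 1 + n) + 1 := by omega
      rw [e] at hU ⊢
      set K := i + 1 + n with hK
      have hiK : i < K := by omega
      have hΛ : 0 ≤ Λ₀ / Real.cos m ^ n := div_nonneg hΛ₀ (pow_nonneg hc.le n)
      have step := analyticHistory_step (D K) (τ K) (Ec K) (fun t y => E K (Function.update g i t) y) (Dom K) O
        (g K) (R K (g K) U) U hO hOc hOre hΛ hm0 hm (hτ K U hU)
        (fun y hy => (ih y hy).1) (fun y hy => (ih y hy).2.1) (fun y hy => (ih y hy).2.2.1) (fun y hy => (ih y hy).2.2.2)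
        (hmeasC K hiK U hU) (hmeasE K hiK U hU) (fun t ht => hint t ht K hiK U hU) (fun t ht => hpos t ht K hiK U hU)
      have hfun : ∀ z ∈ O, Ec (K + 1) z U = Complex.log (∫ B, ((D K).χ U B : ℂ) *
          cexp (((D K).P (g K) U B : ℂ) + Ec K z (τ K (g K) U B)) ∂((D K).μ U)) + (R K (g K) U : ℂ) :=
        fun z hz => hrecC K hiK z hz U hU
      refine ⟨step.1.congr hfun, fun z hz => ?_, fun z hz => ?_, fun t ht => ?_⟩
      · rw [hfun z hz]; exact step.2.1 z hz
      · have hev : (fun z => Ec (K + 1) z U) =ᶠ[𝓝 z] fun z => Complex.log (∫ B, ((D K).χ U B : ℂ) *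
            cexp (((D K).P (g K) U B : ℂ) + Ec K z (τ K (g K) U B)) ∂((D K).μ U)) + (R K (g K) U : ℂ) :=
          Filter.eventually_of_mem (hO.mem_nhds hz) fun w hw => hfun w hw
        rw [hev.deriv_eq, pow_succ, ← div_div]
        exact step.2.2.1 z hz
      · rw [hfun t ht, step.2.2.2 t ht, hrec t ht K hiK U hU]
  intro k hk U hU
  obtain ⟨n, rfl⟩ : ∃ n, k = i + 1 + n := ⟨k - (i + 1), by omega⟩
  have e : i + 1 + n - (i + 1) = n := by omega
  rw [e]
  exact main n U hU

/-- **COROLLARY — THE COMPLEXIFIED ACTION STAYS `Λ_k|Im z|`-CLOSE TO THE REAL ONE**: under the letters of `analyticHistory_letters` at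
level `k > i`, for `U ∈ Dom k` and `z ∈ O`: `‖Ec k z U − E k (g with g_i := Re z) U‖ ≤ (Λ₀ ∕ (cos m)^{k−1−i})·|Im z|` (vertical mean
value + real compatibility) — the real shadow of the complexified tower is the real tower at the real part of the coupling, up to a
deviation linear in the distance from the real axis. [cite: Balaban1987RG1, p.266 (after (2.9)) and §0 (0.23) p.256] -/
theorem norm_sub_real_le_of_letters (E : ℕ → (ℕ → ℝ) → Y → ℝ) (Ec : ℕ → ℂ → Y → ℂ) (Dom : ℕ → Set Y) (O : Set ℂ)
    {m Λ₀ : ℝ} (g : ℕ → ℝ) (i : ℕ) (hO : IsOpen O) (hOc : Convex ℝ O) (hOre : ∀ z ∈ O, ((z.re : ℝ) : ℂ) ∈ O)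
    (hletters : ∀ k, i < k → ∀ U ∈ Dom k,
      DifferentiableOn ℂ (fun z => Ec k z U) O ∧
      (∀ z ∈ O, |(Ec k z U).im| ≤ m) ∧
      (∀ z ∈ O, ‖deriv (fun z => Ec k z U) z‖ ≤ Λ₀ / Real.cos m ^ (k - (i + 1))) ∧
      (∀ t : ℝ, (t : ℂ) ∈ O → Ec k t U = E k (Function.update g i t) U))
    {k : ℕ} (hk : i < k) {U : Y} (hU : U ∈ Dom k) {z : ℂ} (hz : z ∈ O) :
    ‖Ec k z U - (E k (Function.update g i z.re) U : ℂ)‖ ≤ Λ₀ / Real.cos m ^ (k - (i + 1)) * |z.im| := by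
  obtain ⟨hdiff, -, hderiv, hreal⟩ := hletters k hk U hU
  rw [← hreal z.re (hOre z hz)]
  exact norm_sub_real_le hO hOc hdiff hderiv hz (hOre z hz)

end Tower

/-! ## §4 (v1.1, APPEND-ONLY; §§1–3 byte-identical). The birth letter from exponent-level letters

At the BIRTH level `i + 1` the complexified coupling `z = g_i` is the LAST one: it enters the exponent `𝐏^{(i)}(z, U, B) + 𝐄_i(τ_i(z, U, B))`
(both parts) and the history-free remainder `R_i(z, U)`.  The cone comparison principle of §§1–2 applies verbatim with the real base
`p := 0` and the whole exponent as the complex bracket: the four-part birth letter of `analyticHistory_letters` follows from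
EXPONENT-LEVEL letters (holomorphy, imaginary-part letter `m₁`, derivative letter `L₁`, real compatibility — for Bałaban: (1.17) on the
complex small-field domain ∘ the substitution of (2.12), module `B12Eq212BracketCoupling`, and `B12ZeroCoupling268` for `𝐏^{(i)}`;
DISPLAYED) and the same letters `m₂, L₂` for the remainder, with `m = m₁ + m₂`, `Λ₀ = L₁ ∕ cos m₁ + L₂`. -/

section Birth

variable {Y : Type*}

/-- **THE BIRTH LETTER FROM EXPONENT-LEVEL LETTERS** (level `i + 1`, the complexified coupling is the LAST one).  Datum `D`, configuration
`U`; the complexified exponent `Fc_z(B)` (print's `𝐏^{(i)}(z,U,B) + 𝐄_i(U_i(exp i[zCB − hD̃(zCB)]V^{(i)}))` at complex `g_i = z`) with, on the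
support of `χ_U`: holomorphy on the open convex `O` (closed under `z ↦ Re z`), `|Im Fc_z| ≤ m₁`, `‖∂_z Fc_z‖ ≤ L₁`, `Fc_t = F^ℝ_t` on real
points; the complexified remainder `Rc` holomorphic on `O` with `|Im Rc| ≤ m₂`, `‖Rc′‖ ≤ L₂`, `Rc t = R^ℝ t`; measurable integrands and
exponents; the real integrands `χ_U e^{F^ℝ_t}` integrable with positive integrals (`0 ≤ m₁`, `m₁ < π∕2`, `0 ≤ L₁`).  Then the birth action
`N(z) = log ∫ χ_U e^{Fc_z} dμ_U + Rc(z)` is holomorphic on `O` with **imaginary-part letter `m₁ + m₂`**, **derivative letter `L₁ ∕ cos m₁ + L₂`**,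
and `N(t) = log ∫ χ_U e^{F^ℝ_t} dμ_U + R^ℝ(t)` on real points — the hypotheses `hb_diff ∕ hb_im ∕ hb_deriv ∕ hb_real` of
`analyticHistory_letters`. [cite: Balaban1987RG1, p.263 (clause before (1.18)), p.266 (after (2.9)) and (2.12)–(2.13) p.268] -/
theorem birth_letters (D : FluctData Y) (U : Y) (Fc : ℂ → D.𝓑 → ℂ) (Fr : ℝ → D.𝓑 → ℝ) (Rc : ℂ → ℂ) (Rr : ℝ → ℝ)
    (O : Set ℂ) {m₁ m₂ L₁ L₂ : ℝ}
    (hO : IsOpen O) (hOc : Convex ℝ O) (hOre : ∀ z ∈ O, ((z.re : ℝ) : ℂ) ∈ O) (hL₁ : 0 ≤ L₁) (hm₁0 : 0 ≤ m₁) (hm₁ : m₁ < π / 2)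
    (hF_diff : ∀ B, D.χ U B ≠ 0 → DifferentiableOn ℂ (fun z => Fc z B) O)
    (hF_im : ∀ B, D.χ U B ≠ 0 → ∀ z ∈ O, |(Fc z B).im| ≤ m₁)
    (hF_deriv : ∀ B, D.χ U B ≠ 0 → ∀ z ∈ O, ‖deriv (fun z => Fc z B) z‖ ≤ L₁)
    (hF_real : ∀ B, D.χ U B ≠ 0 → ∀ t : ℝ, (t : ℂ) ∈ O → Fc t B = Fr t B)
    (hR_diff : DifferentiableOn ℂ Rc O) (hR_im : ∀ z ∈ O, |(Rc z).im| ≤ m₂) (hR_deriv : ∀ z ∈ O, ‖deriv Rc z‖ ≤ L₂)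
    (hR_real : ∀ t : ℝ, (t : ℂ) ∈ O → Rc t = Rr t)
    (hmeasC : ∀ z ∈ O, AEStronglyMeasurable (fun B => (D.χ U B : ℂ) * cexp (Fc z B)) (D.μ U))
    (hmeasE : ∀ z ∈ O, AEStronglyMeasurable (fun B => Fc z B) (D.μ U))
    (hint : ∀ t : ℝ, (t : ℂ) ∈ O → Integrable (fun B => D.χ U B * Real.exp (Fr t B)) (D.μ U))
    (hpos : ∀ t : ℝ, (t : ℂ) ∈ O → 0 < ∫ B, D.χ U B * Real.exp (Fr t B) ∂(D.μ U)) :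
    DifferentiableOn ℂ (fun z => Complex.log (∫ B, (D.χ U B : ℂ) * cexp (Fc z B) ∂(D.μ U)) + Rc z) O ∧
    (∀ z ∈ O, |(Complex.log (∫ B, (D.χ U B : ℂ) * cexp (Fc z B) ∂(D.μ U)) + Rc z).im| ≤ m₁ + m₂) ∧
    (∀ z ∈ O, ‖deriv (fun z => Complex.log (∫ B, (D.χ U B : ℂ) * cexp (Fc z B) ∂(D.μ U)) + Rc z) z‖ ≤ L₁ / Real.cos m₁ + L₂) ∧
    (∀ t : ℝ, (t : ℂ) ∈ O → Complex.log (∫ B, (D.χ U B : ℂ) * cexp (Fc t B) ∂(D.μ U)) + Rc t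
      = ((Real.log (∫ B, D.χ U B * Real.exp (Fr t B) ∂(D.μ U)) + Rr t : ℝ) : ℂ)) := by
  -- §2 with the real base `p := 0` and the whole exponent as the bracket
  have h0 : ∀ B, 0 ≤ D.χ U B := D.χ_nonneg U
  have e0 : ∀ (w : ℂ), (((0 : ℝ) : ℂ) + w) = w := fun w => by simp
  have hmeasC' : ∀ z ∈ O, AEStronglyMeasurable (fun B => (D.χ U B : ℂ) * cexp (((0 : ℝ) : ℂ) + Fc z B)) (D.μ U) :=
    fun z hz => by simpa only [e0] using hmeasC z hz
  have hint' : ∀ t : ℝ, (t : ℂ) ∈ O → Integrable (fun B => D.χ U B * Real.exp ((0 : ℝ) + Fr t B)) (D.μ U) :=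
    fun t ht => by simpa only [zero_add] using hint t ht
  have hpos' : ∀ t : ℝ, (t : ℂ) ∈ O → 0 < ∫ B, D.χ U B * Real.exp ((0 : ℝ) + Fr t B) ∂(D.μ U) :=
    fun t ht => by simpa only [zero_add] using hpos t ht
  have hF_real' : ∀ B, D.χ U B ≠ 0 → ∀ t : ℝ, (t : ℂ) ∈ O → Fc t B = ((Fr t B : ℝ) : ℂ) := hF_real
  have key : ∀ z₀ ∈ O, _ := fun z₀ hz₀ =>
    clog_paramIntegral_letters (μ := D.μ U) (χ := D.χ U) (p := fun _ => (0 : ℝ)) (q := Fc) (qr := Fr)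
      h0 hO hOc hOre hL₁ hm₁0 hm₁ hF_diff hF_im hF_deriv hF_real' hmeasC' hmeasE hint' hpos' hz₀
  refine ⟨?_, ?_, ?_, ?_⟩
  · intro z hz
    have h1 := (key z hz).2.1.differentiableAt
    simp only [e0] at h1
    have h2 : DifferentiableAt ℂ (fun z => Complex.log (∫ B, (D.χ U B : ℂ) * cexp (Fc z B) ∂(D.μ U)) + Rc z) z :=
      h1.add (hR_diff.differentiableAt (hO.mem_nhds hz))
    exact h2.differentiableWithinAt
  · intro z hz
    have h1 := (key z hz).2.2.2
    simp only [e0] at h1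
    rw [Complex.add_im]
    exact (abs_add_le _ _).trans (add_le_add h1 (hR_im z hz))
  · intro z hz
    have hd := (key z hz).2.1
    have hb := (key z hz).2.2.1
    simp only [e0] at hd hb
    have hR := (hR_diff.differentiableAt (hO.mem_nhds hz)).hasDerivAt
    have hsum : HasDerivAt (fun z => Complex.log (∫ B, (D.χ U B : ℂ) * cexp (Fc z B) ∂(D.μ U)) + Rc z)
        ((∫ B, (D.χ U B : ℂ) * cexp (Fc z B) * deriv (fun z => Fc z B) z ∂(D.μ U)) /
            (∫ B, (D.χ U B : ℂ) * cexp (Fc z B) ∂(D.μ U)) + deriv Rc z) z := hd.add hR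
    rw [hsum.deriv]
    exact (norm_add_le _ _).trans (add_le_add hb (hR_deriv z hz))
  · intro t ht
    have hI := paramIntegral_ofReal (μ := D.μ U) (χ := D.χ U) (p := fun _ => (0 : ℝ)) (q := Fc) (qr := Fr) hF_real' ht
    simp only [e0, zero_add] at hI
    have hI0 : 0 ≤ ∫ B, D.χ U B * Real.exp (Fr t B) ∂(D.μ U) := (hpos t ht).le
    rw [hI, hR_real t ht, ← Complex.ofReal_log hI0]
    push_cast
    ring

end Birth

/-! ## §5 (v1.2). The exponent's letters from its parts -/

section Parts

variable {Ω : Type*}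

/-- **THE FOUR EXPONENT-LEVEL LETTERS OF A SUM FROM THOSE OF THE PARTS** (`Fc = Pc + Qc`: print's `𝐏^{(i)} + {…}` with the last coupling
complexified): on an open `O`, wherever `χ ≠ 0`, holomorphy is inherited, the imaginary-part letters add (`m_P + m_Q`), the derivative
letters add (`L_P + L_Q`), and reality on real points is inherited (`P^ℝ_t + Q^ℝ_t`) — the hypotheses `hF_diff ∕ hF_im ∕ hF_deriv ∕ hF_real`
of `birth_letters` for the whole exponent. [cite: Balaban1987RG1, (2.12)–(2.13) p.268 and p.266 (after (2.9))] -/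
theorem exponent_letters_add {χ : Ω → ℝ} {Pc Qc : ℂ → Ω → ℂ} {Pr Qr : ℝ → Ω → ℝ} {O : Set ℂ} {mP mQ LP LQ : ℝ} (hO : IsOpen O)
    (hP_diff : ∀ ω, χ ω ≠ 0 → DifferentiableOn ℂ (fun z => Pc z ω) O)
    (hP_im : ∀ ω, χ ω ≠ 0 → ∀ z ∈ O, |(Pc z ω).im| ≤ mP)
    (hP_deriv : ∀ ω, χ ω ≠ 0 → ∀ z ∈ O, ‖deriv (fun z => Pc z ω) z‖ ≤ LP)
    (hP_real : ∀ ω, χ ω ≠ 0 → ∀ t : ℝ, (t : ℂ) ∈ O → Pc t ω = Pr t ω)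
    (hQ_diff : ∀ ω, χ ω ≠ 0 → DifferentiableOn ℂ (fun z => Qc z ω) O)
    (hQ_im : ∀ ω, χ ω ≠ 0 → ∀ z ∈ O, |(Qc z ω).im| ≤ mQ)
    (hQ_deriv : ∀ ω, χ ω ≠ 0 → ∀ z ∈ O, ‖deriv (fun z => Qc z ω) z‖ ≤ LQ)
    (hQ_real : ∀ ω, χ ω ≠ 0 → ∀ t : ℝ, (t : ℂ) ∈ O → Qc t ω = Qr t ω) :
    (∀ ω, χ ω ≠ 0 → DifferentiableOn ℂ (fun z => Pc z ω + Qc z ω) O) ∧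
    (∀ ω, χ ω ≠ 0 → ∀ z ∈ O, |(Pc z ω + Qc z ω).im| ≤ mP + mQ) ∧
    (∀ ω, χ ω ≠ 0 → ∀ z ∈ O, ‖deriv (fun z => Pc z ω + Qc z ω) z‖ ≤ LP + LQ) ∧
    (∀ ω, χ ω ≠ 0 → ∀ t : ℝ, (t : ℂ) ∈ O → Pc t ω + Qc t ω = ((Pr t ω + Qr t ω : ℝ) : ℂ)) := by
  refine ⟨fun ω hχ => (hP_diff ω hχ).add (hQ_diff ω hχ), fun ω hχ z hz => ?_, fun ω hχ z hz => ?_, fun ω hχ t ht => ?_⟩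
  · rw [Complex.add_im]
    exact (abs_add_le _ _).trans (add_le_add (hP_im ω hχ z hz) (hQ_im ω hχ z hz))
  · have hPd := ((hP_diff ω hχ).differentiableAt (hO.mem_nhds hz)).hasDerivAt
    have hQd := ((hQ_diff ω hχ).differentiableAt (hO.mem_nhds hz)).hasDerivAt
    have hsum : HasDerivAt (fun z => Pc z ω + Qc z ω) (deriv (fun z => Pc z ω) z + deriv (fun z => Qc z ω) z) z := hPd.add hQd
    rw [hsum.deriv]
    exact (norm_add_le _ _).trans (add_le_add (hP_deriv ω hχ z hz) (hQ_deriv ω hχ z hz))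
  · rw [hP_real ω hχ t ht, hQ_real ω hχ t ht]
    push_cast
    ring

/-- **LETTERS OF ONE PART FROM A SUP BOUND ON A LARGER DISC** (the shape in which lit-balaban's `B12ZeroCoupling268` delivers the displayed
terms of `𝐏^{(k)}`: analytic in the complex coupling on a disc with an explicit norm bound): a function holomorphic on `|z − c| < r′` with
`‖f‖ ≤ M` there has, at every point of the smaller disc `|z − c| < r` (`r < r′`), **the imaginary-part letter `M`** and **the derivative
letter `M ∕ (r′ − r)`** (Cauchy's estimate on the circle of radius `r′ − r`; any `r < r′`). [cite: Balaban1987RG1, (2.12)–(2.13) p.268 and p.266 (after (2.9))] -/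
theorem letters_of_norm_le {f : ℂ → ℂ} {c : ℂ} {r r' M : ℝ} (hrr' : r < r')
    (hf : DifferentiableOn ℂ f (Metric.ball c r')) (hM : ∀ z ∈ Metric.ball c r', ‖f z‖ ≤ M) :
    (∀ z ∈ Metric.ball c r, |(f z).im| ≤ M) ∧ (∀ z ∈ Metric.ball c r, ‖deriv f z‖ ≤ M / (r' - r)) := by
  have hsub : Metric.ball c r ⊆ Metric.ball c r' := Metric.ball_subset_ball hrr'.le
  refine ⟨fun z hz => (Complex.abs_im_le_norm _).trans (hM z (hsub hz)), fun z hz => ?_⟩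
  have hρ : 0 < r' - r := sub_pos.2 hrr'
  have hz' : ‖z - c‖ < r := by rwa [Metric.mem_ball, dist_eq_norm] at hz
  have hcl : Metric.closedBall z (r' - r) ⊆ Metric.ball c r' := by
    intro w hw
    rw [Metric.mem_closedBall, dist_eq_norm] at hw
    rw [Metric.mem_ball, dist_eq_norm]
    calc ‖w - c‖ ≤ ‖w - z‖ + ‖z - c‖ := norm_sub_le_norm_sub_add_norm_sub w z c
      _ < (r' - r) + r := add_lt_add_of_le_of_lt hw hz'
      _ = r' := by ring
  have hdc : DiffContOnCl ℂ f (Metric.ball z (r' - r)) := hf.diffContOnCl_ball hcl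
  have hC : ∀ w ∈ Metric.sphere z (r' - r), ‖f w‖ ≤ M := fun w hw =>
    hM w (hcl (Metric.sphere_subset_closedBall hw))
  exact Complex.norm_deriv_le_of_forall_mem_sphere_norm_le hρ hdc hC

end Parts

end Literature.MathematicalPhysics.QuantumFieldTheory.Balaban1983to89.B12Eq213AnalyticHistory

end
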